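import Mathlib
import HarnessLib

/-!
# Total-degree bookkeeping for determinants and adjugates of polynomial matrices

For a square matrix over `MvPolynomial σ R` whose entries in column `c` have total degree
`≤ d c`, the determinant and every adjugate entry have total degree `≤ Σ_c d c` (Leibniz
expansion), and ring-homomorphic evaluation commutes with the adjugate entrywise.  Used to
certify band limits (bounded polynomial degree in a few matrix-valued variables) of cofactors of
large structured matrices, e.g. lattice Dirac operators in their link variables.
-/

namespace Literature.LinearAlgebra.Matrix

open MvPolynomial _root_.Matrix
open scoped BigOperators

variable {σ R n : Type*} [CommRing R] [Fintype n] [DecidableEq n]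

/-- The total degree of an integer scalar (as a constant polynomial) is zero. [folklore] -/
theorem totalDegree_intCast_le (z : ℤ) : ((z : MvPolynomial σ R)).totalDegree = 0 := by
  rw [← map_intCast (C : R →+* MvPolynomial σ R) z, totalDegree_C]

/-- **Leibniz degree bound**: column-wise degree bounds add up under `det`. [folklore] -/
theorem totalDegree_det_le (M : Matrix n n (MvPolynomial σ R)) (d : n → ℕ)
    (hM : ∀ j c, (M j c).totalDegree ≤ d c) : M.det.totalDegree ≤ ∑ c, d c := by
  rw [det_apply']
  refine (totalDegree_finsetSum _ _).trans (Finset.sup_le fun τ _ => ?_)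
  refine (totalDegree_mul _ _).trans ?_
  rw [totalDegree_intCast_le, zero_add]
  exact (totalDegree_finsetProd _ _).trans (Finset.sum_le_sum fun c _ => hM _ _)

omit [Fintype n] in
/-- Column-wise degree bounds survive replacing a row by a row of constants (degree `0`). [folklore] -/
theorem totalDegree_updateRow_const_le (M : Matrix n n (MvPolynomial σ R)) (d : n → ℕ)
    (hM : ∀ j c, (M j c).totalDegree ≤ d c) (q : n) (v : n → R) (j c : n) :
    (M.updateRow q (fun c => C (v c)) j c).totalDegree ≤ d c := by
  rw [updateRow_apply]
  split_ifs
  · rw [totalDegree_C]; exact Nat.zero_le _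
  · exact hM j c

/-- **Adjugate degree bound**: every adjugate entry has total degree `≤ Σ_c d c`. [folklore] -/
theorem totalDegree_adjugate_le (M : Matrix n n (MvPolynomial σ R)) (d : n → ℕ)
    (hM : ∀ j c, (M j c).totalDegree ≤ d c) (p q : n) :
    (M.adjugate p q).totalDegree ≤ ∑ c, d c := by
  rw [adjugate_apply]
  have hrow : (Pi.single p (1 : MvPolynomial σ R) : n → MvPolynomial σ R) =
      fun c => C ((Pi.single p (1 : R) : n → R) c) := by
    ext c
    by_cases h : c = p
    · subst h; simp
    · simp [h]
  rw [hrow]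
  exact totalDegree_det_le _ d (totalDegree_updateRow_const_le M d hM q _ )

/-- Evaluation commutes with the adjugate: `eval (adj M) = adj (eval M)` entrywise. [folklore] -/
theorem eval_adjugate_apply (f : MvPolynomial σ R →+* R) (M : Matrix n n (MvPolynomial σ R))
    (p q : n) : f (M.adjugate p q) = (M.map f).adjugate p q := by
  have h := RingHom.map_adjugate f M
  have := congr_fun (congr_fun h p) q
  simpa [RingHom.mapMatrix_apply] using this

end Literature.LinearAlgebra.Matrix
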